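import Summits.CriticalPhenomena.SAWScalingLimit.Theorems.SAWReversalUpgradeFaithfulOfNoReturnSqueeze
import Summits.CriticalPhenomena.SAWScalingLimit.Theorems.SAWReversalUpgradeAttachReversalInvariance
import HarnessLib

/-!
# Route `SAWReversalUpgrade`, support `FaithfulOfNoReturn` (stmt-CriticalPhenomena-18008):
# order bookkeeping of the attachment — last visit of `a`, first visit of `b`, the pushed polyline

Helper file (3 of several) for the proof of
`Summit.CriticalPhenomena.SAWScalingLimit.Theses.SAWReversalUpgrade.FaithfulOfNoReturn`,
in the vocabulary of `SAWReversalUpgradeAttachReversalDefs` (`lastA`, `firstB`, `attZ`, `midSet`).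

For a continuous extended polyline `R : ℝ → ℂ`:
* `lastA a R ∈ [0, 1]` is `0` or a visit time of `a` (`AttachReversal.lastA_spec`, landed by the
  `AttachReversal` prover), and bounds every visit time of `a` from above; dually for `firstB b R`;
* on the *good event* (no `(ε₀, r₀)`-deep return to `a`, no `(r₀, ε₀)`-escape from `b`, endpoints
  `r₀/4`-close to `a`, `b`): the polyline stays `ε₀`-close to `a` up to `lastA`, `ε₀`-close to `b` from
  `firstB` on, and `lastA < firstB`;
* the pushed polyline `attZ b Φ e R = T' ∘ R` (`T'` the patched squeeze of helper file 2): values in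
  `D ∪ {a, b}`, injectivity through `R`, closedness of `midSet`, and where `a`, `b` are hit
  (continuity / `κ`-closeness / the `a`-`b` iff's are the tree's `AttachNoReturn.attZ_*`, or the
  `transport'` lemmas of helper file 2 applied pointwise).
-/

noncomputable section

open Set Filter Metric Complex Function
open scoped Topology
open UpperHalfPlane (upperHalfPlaneSet)
open Literature.Probability.RandomPlanarGeometry

namespace Summit.CriticalPhenomena.SAWScalingLimit.Theorems

namespace FaithfulAttach

open AttachReversal

/-! ### Last visit of `a`, first visit of `b` -/

section Visits

variable {R : ℝ → ℂ}

/-- The set of visit times of a point in `[0, 1]` is closed. -/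
theorem isClosed_visitSet (hRc : Continuous R) (x : ℂ) :
    IsClosed {u : ℝ | u ∈ Icc (0:ℝ) 1 ∧ R u = x} :=
  isClosed_Icc.inter (isClosed_singleton.preimage hRc)

/-- `lastA a R` belongs to its defining set. -/
theorem lastA_mem_set (hRc : Continuous R) (a : ℂ) :
    lastA a R ∈ ({(0:ℝ)} ∪ {u : ℝ | u ∈ Icc (0:ℝ) 1 ∧ R u = a}) := by
  refine IsClosed.csSup_mem (isClosed_singleton.union (isClosed_visitSet hRc a)) ⟨0, Or.inl rfl⟩
    ⟨1, ?_⟩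
  rintro u (hu | hu)
  · rw [mem_singleton_iff.1 hu]
    exact zero_le_one
  · exact hu.1.2

/-- The defining set of `lastA` is bounded above by `1`. -/
theorem bddAbove_lastA_set (a : ℂ) : BddAbove ({(0:ℝ)} ∪ {u : ℝ | u ∈ Icc (0:ℝ) 1 ∧ R u = a}) := by
  refine ⟨1, ?_⟩
  rintro u (hu | hu)
  · rw [mem_singleton_iff.1 hu]
    exact zero_le_one
  · exact hu.1.2

/-- `lastA a R ∈ [0, 1]`. -/
theorem lastA_mem_Icc' (hRc : Continuous R) (a : ℂ) : lastA a R ∈ Icc (0:ℝ) 1 := by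
  rcases lastA_mem_set hRc a with h | h
  · rw [mem_singleton_iff.1 h]
    exact ⟨le_rfl, zero_le_one⟩
  · exact h.1

/-- Every visit time of `a` in `[0, 1]` is at most `lastA a R`. -/
theorem le_lastA {a : ℂ} {u : ℝ} (hu : u ∈ Icc (0:ℝ) 1) (h : R u = a) : u ≤ lastA a R :=
  le_csSup (bddAbove_lastA_set a) (Or.inr ⟨hu, h⟩)

/-- After `lastA a R` the polyline does not visit `a`. -/
theorem ne_of_lastA_lt {a : ℂ} {u : ℝ} (hu : u ∈ Icc (0:ℝ) 1) (h : lastA a R < u) : R u ≠ a :=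
  fun heq => (le_lastA hu heq).not_gt h

/-- `firstB b R` belongs to its defining set. -/
theorem firstB_mem_set (hRc : Continuous R) (b : ℂ) :
    firstB b R ∈ ({(1:ℝ)} ∪ {u : ℝ | u ∈ Icc (0:ℝ) 1 ∧ R u = b}) := by
  refine IsClosed.csInf_mem (isClosed_singleton.union (isClosed_visitSet hRc b)) ⟨1, Or.inl rfl⟩
    ⟨0, ?_⟩
  rintro u (hu | hu)
  · rw [mem_singleton_iff.1 hu]
    exact zero_le_one
  · exact hu.1.1

/-- The defining set of `firstB` is bounded below by `0`. -/
theorem bddBelow_firstB_set (b : ℂ) : BddBelow ({(1:ℝ)} ∪ {u : ℝ | u ∈ Icc (0:ℝ) 1 ∧ R u = b}) := by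
  refine ⟨0, ?_⟩
  rintro u (hu | hu)
  · rw [mem_singleton_iff.1 hu]
    exact zero_le_one
  · exact hu.1.1

/-- `firstB b R ∈ [0, 1]`. -/
theorem firstB_mem_Icc' (hRc : Continuous R) (b : ℂ) : firstB b R ∈ Icc (0:ℝ) 1 := by
  rcases firstB_mem_set hRc b with h | h
  · rw [mem_singleton_iff.1 h]
    exact ⟨zero_le_one, le_rfl⟩
  · exact h.1

/-- Every visit time of `b` in `[0, 1]` is at least `firstB b R`. -/
theorem firstB_le {b : ℂ} {u : ℝ} (hu : u ∈ Icc (0:ℝ) 1) (h : R u = b) : firstB b R ≤ u :=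
  csInf_le (bddBelow_firstB_set b) (Or.inr ⟨hu, h⟩)

/-- Before `firstB b R` the polyline does not visit `b`. -/
theorem ne_of_lt_firstB {b : ℂ} {u : ℝ} (hu : u ∈ Icc (0:ℝ) 1) (h : u < firstB b R) : R u ≠ b :=
  fun heq => (firstB_le hu heq).not_gt h

/-- If the endpoint `R 1` is not `b`, then `R (firstB b R) = b` forces `firstB b R < 1`. -/
theorem firstB_lt_one_of_eq (hRc : Continuous R) {b : ℂ} (h1 : R 1 ≠ b) (h : R (firstB b R) = b) :
    firstB b R < 1 := by
  rcases (firstB_mem_Icc' hRc b).2.lt_or_eq with hlt | heq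
  · exact hlt
  · rw [heq] at h
    exact absurd h h1

/-- If the endpoint `R 1` is not `b` and `R (firstB b R) ≠ b`, then `firstB b R = 1`. -/
theorem firstB_eq_one_of_ne (hRc : Continuous R) {b : ℂ} (h : R (firstB b R) ≠ b) : firstB b R = 1 := by
  rcases firstB_spec hRc b with h' | h'
  · exact h'
  · exact absurd h' h

end Visits

/-! ### The good event: no deep return to `a`, no escape from `b` -/

section Good

variable {D : DobrushinDomain} {R : ℝ → ℂ} {ε₀ r₀ : ℝ}

/-- On the good event, `R (lastA a R)` is `r₀/4`-close to `a`. -/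
theorem dist_lastA_lt (hRc : Continuous R) (hr₀ : 0 < r₀) (hR0 : dist (R 0) (D.pt 0) < r₀ / 4) :
    dist (R (lastA (D.pt 0) R)) (D.pt 0) < r₀ / 4 := by
  rcases lastA_spec hRc (D.pt 0) with h | h
  · rwa [h]
  · rw [h, dist_self]
    positivity

/-- **No deep return**: up to the last visit of `a` the polyline stays `ε₀`-close to `a`. -/
theorem dist_lt_of_le_lastA (hRc : Continuous R) (hr₀ : 0 < r₀) (hrε : r₀ < ε₀)
    (hR0 : dist (R 0) (D.pt 0) < r₀ / 4)
    (hNR : ∀ s t : ℝ, 0 ≤ s → s < t → t ≤ 1 → ε₀ ≤ dist (R s) (D.pt 0) →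
      dist (R t) (D.pt 0) ≤ r₀ → False)
    {u : ℝ} (hu0 : 0 ≤ u) (hu : u ≤ lastA (D.pt 0) R) : dist (R u) (D.pt 0) < ε₀ := by
  have hi := lastA_mem_Icc' hRc (D.pt 0)
  rcases hu.lt_or_eq with hlt | heq
  · by_contra hge
    rw [not_lt] at hge
    exact hNR u (lastA (D.pt 0) R) hu0 hlt hi.2 hge (by linarith [dist_lastA_lt hRc hr₀ hR0])
  · rw [heq]
    linarith [dist_lastA_lt hRc hr₀ hR0]

/-- **No escape**: from the first visit of `b` on the polyline stays `ε₀`-close to `b`. -/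
theorem dist_lt_of_firstB_le (hRc : Continuous R) (hr₀ : 0 < r₀) (hrε : r₀ < ε₀)
    (hR1 : dist (R 1) (D.pt 1) < r₀ / 4)
    (hNE : ∀ s t : ℝ, 0 ≤ t → t < s → s ≤ 1 → dist (R t) (D.pt 1) ≤ r₀ →
      ε₀ ≤ dist (R s) (D.pt 1) → False)
    {u : ℝ} (hu1 : u ≤ 1) (hu : firstB (D.pt 1) R ≤ u) : dist (R u) (D.pt 1) < ε₀ := by
  have hj := firstB_mem_Icc' hRc (D.pt 1)
  rcases firstB_spec hRc (D.pt 1) with h | h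
  · have : u = 1 := le_antisymm hu1 (h ▸ hu)
    rw [this]
    linarith
  · rcases hu.lt_or_eq with hlt | heq
    · by_contra hge
      rw [not_lt] at hge
      exact hNE u (firstB (D.pt 1) R) hj.1 hlt hu1 (by rw [h, dist_self]; exact hr₀.le) hge
    · rw [← heq, h, dist_self]
      exact hr₀.trans hrε

/-- On the good event, `lastA a R < firstB b R`. -/
theorem lastA_lt_firstB (hRc : Continuous R) (hr₀ : 0 < r₀) (hrε : r₀ < ε₀)
    (hab : 2 * ε₀ ≤ dist (D.pt 0) (D.pt 1))
    (hR0 : dist (R 0) (D.pt 0) < r₀ / 4) (hR1 : dist (R 1) (D.pt 1) < r₀ / 4)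
    (hNE : ∀ s t : ℝ, 0 ≤ t → t < s → s ≤ 1 → dist (R t) (D.pt 1) ≤ r₀ →
      ε₀ ≤ dist (R s) (D.pt 1) → False) :
    lastA (D.pt 0) R < firstB (D.pt 1) R := by
  by_contra h
  rw [not_lt] at h
  have hi := lastA_mem_Icc' hRc (D.pt 0)
  have h1 := dist_lt_of_firstB_le hRc hr₀ hrε hR1 hNE hi.2 h
  have h2 := dist_lastA_lt hRc hr₀ hR0
  have h3 := dist_triangle_left (D.pt 0) (D.pt 1) (R (lastA (D.pt 0) R))
  linarith

/-- A point `ε₀`-close to `a` is not `ε₀`-close to `b` (the marked points are `2ε₀` apart). -/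
theorem not_close_both (hab : 2 * ε₀ ≤ dist (D.pt 0) (D.pt 1)) {x : ℂ}
    (ha : dist x (D.pt 0) < ε₀) (hb : dist x (D.pt 1) < ε₀) : False := by
  have := dist_triangle_left (D.pt 0) (D.pt 1) x
  linarith

end Good

/-! ### The pushed polyline `attZ = T' ∘ R` and the middle arc `midSet` -/

section Pushed

variable {D : DobrushinDomain} {φ : ConformalEquiv upperHalfPlaneSet D.carrier} {e : ℝ} {R : ℝ → ℂ}
  (hφ : D.IsChordalUniformizing φ) (he0 : 0 < e) (he1 : e ≤ 1 / 2)
  (hRc : Continuous R) (hRmem : ∀ u, R u ∈ closure D.carrier)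

/-- `attZ` pointwise: the patched squeeze `T'` of helper file 2 applied to `R u`. -/
theorem attZ_apply (b : ℂ) (Φ : ℂ → ℂ) (e : ℝ) (R : ℝ → ℂ) (u : ℝ) :
    attZ b Φ e R u = @ite ℂ (R u = b) (Classical.propDecidable _) b (Φ (squeeze e (hinv Φ (R u)))) :=
  rfl

include hφ he0 he1 hRmem in
/-- `attZ u ∈ D ∪ {a, b}`. -/
theorem attZ_mem (u : ℝ) :
    attZ (D.pt 1) φ.boundaryExtension e R u ∈ D.carrier ∨
      attZ (D.pt 1) φ.boundaryExtension e R u = D.pt 0 ∨ attZ (D.pt 1) φ.boundaryExtension e R u = D.pt 1 :=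
  transport'_mem hφ he0 he1 (hRmem u)

include hφ he0 he1 hRmem in
/-- `attZ u ∈ closure D`. -/
theorem attZ_mem_closure (u : ℝ) : attZ (D.pt 1) φ.boundaryExtension e R u ∈ closure D.carrier :=
  transport'_mem_closure hφ he0 he1 (hRmem u)

include hφ he0 he1 hRmem in
/-- `attZ u = attZ u' ↔ R u = R u'` (injectivity of `T'` on `closure D`). -/
theorem attZ_eq_attZ_iff (u u' : ℝ) :
    attZ (D.pt 1) φ.boundaryExtension e R u = attZ (D.pt 1) φ.boundaryExtension e R u' ↔ R u = R u' := by
  refine ⟨fun h => transport'_injOn hφ he0 he1 (hRmem u) (hRmem u') h, fun h => ?_⟩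
  rw [attZ_apply, attZ_apply, h]

include hφ he0 he1 hRc hRmem in
/-- The middle arc `midSet` is closed. -/
theorem isClosed_midSet :
    IsClosed (midSet (D.pt 0) (D.pt 1) φ.boundaryExtension e R) := by
  have hZc : Continuous (attZ (D.pt 1) φ.boundaryExtension e R) :=
    (continuousOn_transport' hφ he0 he1).comp_continuous hRc hRmem
  exact (isCompact_Icc.image hZc).isClosed

include hφ he0 he1 hRc hRmem in
/-- If `a ∈ midSet` then `R (lastA a R) = a` (a visit of `a` inside `[lastA, firstB]` is at `lastA`). -/
theorem apply_lastA_eq_of_pt_zero_mem_midSet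
    (h : D.pt 0 ∈ midSet (D.pt 0) (D.pt 1) φ.boundaryExtension e R) : R (lastA (D.pt 0) R) = D.pt 0 := by
  obtain ⟨u, hu, hua⟩ := h
  replace hua := (transport'_eq_pt_zero_iff hφ he0 he1 (hRmem u)).1 hua
  have hu01 : u ∈ Icc (0:ℝ) 1 :=
    ⟨(lastA_mem_Icc' hRc (D.pt 0)).1.trans hu.1, hu.2.trans (firstB_mem_Icc' hRc (D.pt 1)).2⟩
  have := le_lastA hu01 hua
  rwa [le_antisymm this hu.1] at hua

include hφ he0 he1 hRmem in
/-- Conversely, if `R (lastA a R) = a` (and `lastA ≤ firstB`) then `a ∈ midSet`. -/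
theorem pt_zero_mem_midSet (hij : lastA (D.pt 0) R ≤ firstB (D.pt 1) R)
    (h : R (lastA (D.pt 0) R) = D.pt 0) : D.pt 0 ∈ midSet (D.pt 0) (D.pt 1) φ.boundaryExtension e R :=
  ⟨lastA (D.pt 0) R, ⟨le_rfl, hij⟩, (transport'_eq_pt_zero_iff hφ he0 he1 (hRmem _)).2 h⟩

include hφ he0 he1 hRc hRmem in
/-- If `b ∈ midSet` then `R (firstB b R) = b`. -/
theorem apply_firstB_eq_of_pt_one_mem_midSet
    (h : D.pt 1 ∈ midSet (D.pt 0) (D.pt 1) φ.boundaryExtension e R) : R (firstB (D.pt 1) R) = D.pt 1 := by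
  obtain ⟨u, hu, hub⟩ := h
  replace hub := (transport'_eq_pt_one_iff hφ he0 he1 (hRmem u)).1 hub
  have hu01 : u ∈ Icc (0:ℝ) 1 :=
    ⟨(lastA_mem_Icc' hRc (D.pt 0)).1.trans hu.1, hu.2.trans (firstB_mem_Icc' hRc (D.pt 1)).2⟩
  have := firstB_le hu01 hub
  rwa [le_antisymm hu.2 this] at hub

include hφ he0 he1 hRc hRmem in
/-- A time of `[lastA, firstB]` at which the pushed polyline is at `b` is `firstB`. -/
theorem eq_firstB_of_attZ_eq_pt_one {u : ℝ}
    (hu : u ∈ Icc (lastA (D.pt 0) R) (firstB (D.pt 1) R))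
    (h : attZ (D.pt 1) φ.boundaryExtension e R u = D.pt 1) : u = firstB (D.pt 1) R := by
  replace h := (transport'_eq_pt_one_iff hφ he0 he1 (hRmem u)).1 h
  have hu01 : u ∈ Icc (0:ℝ) 1 :=
    ⟨(lastA_mem_Icc' hRc (D.pt 0)).1.trans hu.1, hu.2.trans (firstB_mem_Icc' hRc (D.pt 1)).2⟩
  exact le_antisymm hu.2 (firstB_le hu01 h)

include hφ he0 he1 hRc hRmem in
/-- A time of `[lastA, firstB]` at which the pushed polyline is at `a` is `lastA`. -/
theorem eq_lastA_of_attZ_eq_pt_zero {u : ℝ}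
    (hu : u ∈ Icc (lastA (D.pt 0) R) (firstB (D.pt 1) R))
    (h : attZ (D.pt 1) φ.boundaryExtension e R u = D.pt 0) : u = lastA (D.pt 0) R := by
  replace h := (transport'_eq_pt_zero_iff hφ he0 he1 (hRmem u)).1 h
  have hu01 : u ∈ Icc (0:ℝ) 1 :=
    ⟨(lastA_mem_Icc' hRc (D.pt 0)).1.trans hu.1, hu.2.trans (firstB_mem_Icc' hRc (D.pt 1)).2⟩
  exact le_antisymm (le_lastA hu01 h) hu.1

include hφ he0 he1 hRmem in
/-- Points of `midSet` lie in `D ∪ {a, b}`. -/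
theorem mem_of_mem_midSet {x : ℂ} (hx : x ∈ midSet (D.pt 0) (D.pt 1) φ.boundaryExtension e R) :
    x ∈ D.carrier ∨ x = D.pt 0 ∨ x = D.pt 1 := by
  obtain ⟨u, -, rfl⟩ := hx
  exact attZ_mem hφ he0 he1 hRmem u

end Pushed

end FaithfulAttach

end Summit.CriticalPhenomena.SAWScalingLimit.Theorems
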